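import Mathlib
import Summits.Ventures.HodgeRepro.Tier4.Common.AdelicDefs
import Summits.Ventures.HodgeRepro.Tier4.Common.AdelicRTF
import Summits.Ventures.HodgeRepro.Tier4.Common.MixedPlane

/-!
# Tier4/Common/ThetaLift — the theta-lift vocabulary for rung W1 of the L4 wall (t4-L4-p1 S12896 (iii): «W1 needs a
theta-kernel vocabulary (typer-2) before any prover can touch it»): kernel families on `T′(𝔸_k) × G(𝔸_k)`, the lift
`θ(χ′)(g) = ∫_{[T′]} Θ(t, g) χ′(t) dt`, and the automorphic subspace they span

Blind re-derivation cell `pub-hodge-repro`, Tier 4 (README §9–§10), seat t4-typer-2 (gen 2).  Target tree path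
`lean/Summits/Ventures/HodgeRepro/Tier4/Common/ThetaLift.lean`.  Imports `AdelicDefs`, `AdelicRTF`, `MixedPlane`
(`IsAutomorphicSubspace`).

WHAT IS TYPED, AND WHAT IS NOT.  A theta kernel `θ(t, g; Φ) = Σ_{x ∈ V(k)} (ω(t, g) Φ)(x)` of a dual pair needs the
Weil representation `ω`, which the tree does not have and which no seat can build in Tier-4 time.  What every
construction of a theta LIFT uses of the kernel is three properties — left `G(k)`-invariance in `g`, left
`T′(k)`-invariance in `t`, and stability of the family of kernels under right translation in `g` (`ω(1, h)Φ` is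
again a Schwartz function) — so **`KernelFamily W`** records exactly these as Prop fields on a set of functions
`Θ : T′(𝔸_k) → G(𝔸_k) → ℂ` (DATA, with the printed properties displayed; a lit seat / the planner instantiates it with
the theta kernel of the pair `(T′, U(U))` as printed, Kudla's notes / Harris–Kudla–Sweet).  On top, DEFINED:
**`thetaLift μ D χ′ Θ g := ∫_{t ∈ D} Θ(t, g) χ′(t) dμ(t)`** (the period of the kernel against `χ′` over a fundamental
domain `D` of `T′(k)` in `T′(𝔸_k)`, i.e. `∫_{[T′]}`), **`thetaSpan F μ D χ′`** = the `ℂ`-span of the lifts of the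
family, and PROVED: the lifts are left `G(k)`-invariant (`thetaLift_left_invariant`), right translation of a lift is
the lift of the translated kernel (`thetaLift_right_translate`), and **`isAutomorphicSubspace_thetaSpan`**: the span
is an automorphic subspace in the sense of MixedPlane (`IsAutomorphicSubspace`).  Rung W1's remaining content —
cuspidality, the `K`-types, the non-vanishing `f(1) ≠ 0` of the Riesz vector — is what the PRINTED sources say about
the theta kernel; it is displayed on the family, never proved here.

Nothing here says anything about the status of the Hodge conjecture for CM abelian varieties, which is NOT proved
(HC_CM is NOT proved by anyone in this repository).
-/

set_option autoImplicit false

noncomputable section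

namespace Summit.Ventures.HodgeRepro.Tier4.Common

open MeasureTheory

section Translate

variable {k : Type} [Field k] [NumberField k] (W : PlaneData k)

/-- Right translation `f ↦ (x ↦ f (x g))` as a `ℂ`-linear map on the functions of `G(𝔸_k)`. -/
def rightTranslateLM (g : GA W) : (GA W → ℂ) →ₗ[ℂ] (GA W → ℂ) where
  toFun f := fun x => f (x * g)
  map_add' _ _ := rfl
  map_smul' _ _ := rfl

/-- Right translation, pointwise. -/
theorem rightTranslateLM_apply (g : GA W) (f : GA W → ℂ) (x : GA W) : rightTranslateLM W g f x = f (x * g) := rfl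

/-- **A left-`G(k)`-invariant subspace stable under right translation is automorphic** (`IsAutomorphicSubspace`
of MixedPlane): the generators' invariance passes to the span, and right translation maps the span of a
right-stable generating set into itself. -/
theorem isAutomorphicSubspace_span (S : Set (GA W → ℂ))
    (hinv : ∀ f ∈ S, ∀ (γ : GA W), γ ∈ rationalPoints W → ∀ x, f (γ * x) = f x)
    (hstable : ∀ f ∈ S, ∀ g : GA W, rightTranslateLM W g f ∈ S) :
    IsAutomorphicSubspace W (Submodule.span ℂ S) := by
  refine ⟨?_, ?_⟩
  · intro f hf γ hγ x
    induction hf using Submodule.span_induction with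
    | mem f hfS => exact hinv f hfS γ hγ x
    | zero => rfl
    | add f₁ f₂ _ _ h₁ h₂ => simp only [Pi.add_apply, h₁, h₂]
    | smul c f _ h => simp only [Pi.smul_apply, h]
  · intro f hf g
    have hmap : Submodule.map (rightTranslateLM W g) (Submodule.span ℂ S) ≤ Submodule.span ℂ S := by
      rw [Submodule.map_span, Submodule.span_le]
      rintro _ ⟨f', hf', rfl⟩
      exact Submodule.subset_span (hstable f' hf' g)
    exact hmap ⟨f, hf, rfl⟩

end Translate

section Kernel

variable {k : Type} [Field k] [NumberField k] (W : PlaneData k)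

/-- **A family of theta kernels on `T′(𝔸_k) × G(𝔸_k)`** (the functions `(t, g) ↦ θ(t, g; Φ)`, `Φ` running over the
Schwartz space): the three properties every lift uses, DISPLAYED — left `G(k)`-invariance in `g`, left
`T′(k)`-invariance in `t`, stability under right translation in `g`.  The theta kernel of the pair `(T′, U(U))`
as printed is an instance; nothing here constructs one. -/
structure KernelFamily where
  /-- the kernels -/
  carrier : Set (torusT' W → GA W → ℂ)
  /-- `θ(t, γ g) = θ(t, g)` for rational `γ` -/
  left_invariant : ∀ Θ ∈ carrier, ∀ (γ : GA W), γ ∈ rationalPoints W → ∀ (t : torusT' W) (g : GA W),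
    Θ t (γ * g) = Θ t g
  /-- `θ(δ t, g) = θ(t, g)` for rational `δ ∈ T′(k)` -/
  torus_invariant : ∀ Θ ∈ carrier, ∀ (δ : rationalOf W (torusT' W)) (t : torusT' W) (g : GA W),
    Θ ((δ : torusT' W) * t) g = Θ t g
  /-- the family is stable under right translation in `g` (`ω(1, h) Φ` is again in the Schwartz space) -/
  right_stable : ∀ Θ ∈ carrier, ∀ h : GA W, (fun t g => Θ t (g * h)) ∈ carrier

variable {W} [MeasurableSpace (torusT' W)]

/-- **The theta lift of the character `χ′` through the kernel `Θ`**: `θ(χ′)(g) = ∫_{t ∈ D} Θ(t, g) χ′(t) dμ(t)`, the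
period over the fundamental domain `D` of `T′(k)` in `T′(𝔸_k)` (`∫_{[T′]}`). -/
def thetaLift (μ : Measure (torusT' W)) (D : Set (torusT' W)) (χ' : torusT' W → ℂ) (Θ : torusT' W → GA W → ℂ) :
    GA W → ℂ :=
  fun g => ∫ t in D, Θ t g * χ' t ∂μ

/-- The lift of a left-`G(k)`-invariant kernel is left `G(k)`-invariant. -/
theorem thetaLift_left_invariant (μ : Measure (torusT' W)) (D : Set (torusT' W)) (χ' : torusT' W → ℂ)
    (Θ : torusT' W → GA W → ℂ)
    (hΘ : ∀ (γ : GA W), γ ∈ rationalPoints W → ∀ (t : torusT' W) (g : GA W), Θ t (γ * g) = Θ t g)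
    (γ : GA W) (hγ : γ ∈ rationalPoints W) (g : GA W) :
    thetaLift μ D χ' Θ (γ * g) = thetaLift μ D χ' Θ g := by
  simp only [thetaLift, hΘ γ hγ]

/-- Right translation of a lift is the lift of the translated kernel. -/
theorem thetaLift_right_translate (μ : Measure (torusT' W)) (D : Set (torusT' W)) (χ' : torusT' W → ℂ)
    (Θ : torusT' W → GA W → ℂ) (h : GA W) :
    rightTranslateLM W h (thetaLift μ D χ' Θ) = thetaLift μ D χ' (fun t g => Θ t (g * h)) := rfl

/-- **The space spanned by the theta lifts of a kernel family.** -/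
def thetaSpan (F : KernelFamily W) (μ : Measure (torusT' W)) (D : Set (torusT' W)) (χ' : torusT' W → ℂ) :
    Submodule ℂ (GA W → ℂ) :=
  Submodule.span ℂ (thetaLift μ D χ' '' F.carrier)

/-- Every lift of the family lies in the span. -/
theorem thetaLift_mem_thetaSpan (F : KernelFamily W) (μ : Measure (torusT' W)) (D : Set (torusT' W))
    (χ' : torusT' W → ℂ) {Θ : torusT' W → GA W → ℂ} (hΘ : Θ ∈ F.carrier) :
    thetaLift μ D χ' Θ ∈ thetaSpan F μ D χ' :=
  Submodule.subset_span ⟨Θ, hΘ, rfl⟩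

/-- **The span of the theta lifts is an automorphic subspace** (left `G(k)`-invariant, stable under right
translation) — the shape `IsAdmissible` / `IsRieszVector` of the L4 wall cut quantify over. -/
theorem isAutomorphicSubspace_thetaSpan (F : KernelFamily W) (μ : Measure (torusT' W)) (D : Set (torusT' W))
    (χ' : torusT' W → ℂ) : IsAutomorphicSubspace W (thetaSpan F μ D χ') := by
  refine isAutomorphicSubspace_span W _ ?_ ?_
  · rintro _ ⟨Θ, hΘ, rfl⟩ γ hγ x
    exact thetaLift_left_invariant μ D χ' Θ (F.left_invariant Θ hΘ) γ hγ x
  · rintro _ ⟨Θ, hΘ, rfl⟩ g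
    exact ⟨fun t g' => Θ t (g' * g), F.right_stable Θ hΘ g, (thetaLift_right_translate μ D χ' Θ g).symm⟩

end Kernel

end Summit.Ventures.HodgeRepro.Tier4.Common

end
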